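import Summits.ABC.ABC.Theses.AntisymmetricTwoTorsion
import Summits.ABC.ABC.Theorems.AntisymmetricTwoTorsionTraceDefectPayoffStubCurveForm
import Summits.ABC.ABC.Theorems.AntisymmetricTwoTorsionTraceDefectPayoffStubClassTripleBound
import HarnessLib

/-!
# Route `AntisymmetricTwoTorsion` — crux `TraceDefectPayoff` (stmt-ABC-23395), line `birth`

`Summit.ABC.ABC.Theses.AntisymmetricTwoTorsion.TraceDefectPayoff :=
RadAFreeEngine → TwoTorsionDictionary → TraceDefectSubexpSzpiro`: the rad(a)-free engine
(Pasten–Sepúlveda-Manzo 2025, Thm 2.2) and the two-torsion dictionary give subexponential Szpiro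
UP TO THE TRACE DEFECT `12 log (1 + |a|)` on the antisymmetric two-torsion class
`W = ⟨0, a, 0, b, 0⟩`, `gcd (a, b) = 1`, `b (a² − 4b) ≠ 0`, NOT (`b > 0 ∧ a² − 4b > 0`).

Composition of the two registered stubs of the birth skeleton (both PROVED in the tree):
* `stub_classTripleBound` (`…StubClassTripleBound.lean`): `log M ≤ 4 log (1 + |a|) + C · rad ^ ε`,
  `M = max (4|b|, |a² − 4b|)`, `rad = rad (b (a² − 4b))`;
* `stub_curveForm` (`…StubCurveForm.lean`): `log |Δ_min| ≤ log 64 + 3 log M`, `rad ≤ 2 N_W`,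
  `1 ≤ N_W`;
whence `log |Δ_min (W)| ≤ 12 log (1 + |a|) + (log 64 + 3 max (C, 0) · 2 ^ ε) · N_W ^ ε`.

HONESTY. The class corollary `TraceDefectSubexpSzpiro` (rung A1′ up to a trace defect on a thin
class) is NOT abc and NOT A-PS; this payoff is bookkeeping; moves no rung.

## References

* H. Pasten, R. Sepúlveda-Manzo, Bull. Braz. Math. Soc. 56 (2025) = arXiv:2406.05083, Thm 2.2.
  [PastenSepulvedaManzo2025Abcd]
* J. H. Silverman, *The Arithmetic of Elliptic Curves*, 2nd ed. 2009, VII.1, VIII.8.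
  [SilvermanAEC2009]
-/

-- `Summit.<Summit>.<Problem>` is the mandated summit-side namespace (CONVENTIONS §2); for the
-- single-conjunct summit `ABC` the two coincide, so the duplicate `ABC.ABC` is deliberate.
set_option linter.dupNamespace false

namespace Summit.ABC.ABC.Theorems.TraceDefectPayoffLine

open UniqueFactorizationMonoid
open Summit.ABC.ABC.Theses.AntisymmetricTwoTorsion

/-- Real bookkeeping of the composition: from `D ≤ log 64 + 3 m`, `m ≤ 4 α + C ρ`,
`0 ≤ ρ ≤ P · Q` (`P = 2 ^ ε`, `Q = N ^ ε ≥ 1`) conclude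
`D ≤ 12 α + (log 64 + 3 max (C, 0) 2 ^ ε) N ^ ε`. [folklore] -/
theorem compose_bound {D m α C ρ P Q : ℝ} (hD : D ≤ Real.log 64 + 3 * m)
    (hm : m ≤ 4 * α + C * ρ) (hρ0 : 0 ≤ ρ) (hρ : ρ ≤ P * Q) (hQ : 1 ≤ Q) :
    D ≤ 12 * α + (Real.log 64 + 3 * max C 0 * P) * Q := by
  have h64 : 0 ≤ Real.log 64 := Real.log_nonneg (by norm_num)
  have hC : C * ρ ≤ max C 0 * ρ := mul_le_mul_of_nonneg_right (le_max_left _ _) hρ0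
  have hC' : max C 0 * ρ ≤ max C 0 * (P * Q) := mul_le_mul_of_nonneg_left hρ (le_max_right _ _)
  have h64' : Real.log 64 ≤ Real.log 64 * Q := le_mul_of_one_le_right h64 hQ
  nlinarith [le_max_right C 0]

/-- **`TraceDefectPayoff_of`**: the registered composition — `stub_classTripleBound` and
`stub_curveForm` give `RadAFreeEngine → TwoTorsionDictionary → TraceDefectSubexpSzpiro` with the
constant `log 64 + 3 max (C, 0) 2 ^ ε`. [folklore] -/
theorem TraceDefectPayoff_of (h₁ : RadAFreeEngine) (h₂ : TwoTorsionDictionary) :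
    TraceDefectSubexpSzpiro := by
  intro ε hε
  obtain ⟨C, hC⟩ := stub_classTripleBound h₁ ε hε
  refine ⟨Real.log 64 + 3 * max C 0 * (2 : ℝ) ^ ε, ?_⟩
  intro a b hab hb hd hsign W _ hW
  obtain ⟨hΔ, hrad, hN⟩ := stub_curveForm h₂ a b hab hb hd W hW
  have hM := hC a b hab hb hd hsign
  set ρ : ℝ := (((radical (b * (a ^ 2 - 4 * b))).natAbs : ℕ) : ℝ) ^ ε with hρ
  have hr0 : (0 : ℝ) ≤ (((radical (b * (a ^ 2 - 4 * b))).natAbs : ℕ) : ℝ) := Nat.cast_nonneg _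
  have hρ0 : 0 ≤ ρ := Real.rpow_nonneg hr0 ε
  have hN0 : (0 : ℝ) ≤ (W.conductorNorm ℤ : ℝ) := Nat.cast_nonneg _
  have hρle : ρ ≤ (2 : ℝ) ^ ε * (W.conductorNorm ℤ : ℝ) ^ ε := by
    rw [← Real.mul_rpow (by norm_num) hN0]
    exact Real.rpow_le_rpow hr0 hrad hε.le
  have hQ : 1 ≤ (W.conductorNorm ℤ : ℝ) ^ ε := Real.one_le_rpow hN hε.le
  exact compose_bound hΔ hM hρ0 hρle hQ

end Summit.ABC.ABC.Theorems.TraceDefectPayoffLine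

namespace Summit.ABC.ABC.Theorems

/-- **Closes stmt-ABC-23395**: `Summit.ABC.ABC.Theses.AntisymmetricTwoTorsion.TraceDefectPayoff` —
the rad(a)-free engine and the two-torsion dictionary give the trace-defect bound (line `birth`,
both stubs proved). NOT abc; the served class corollary is rung A1′ up to a trace defect on a
thin class; moves no rung. [cite: PastenSepulvedaManzo2025Abcd, Thm 2.2] -/
theorem traceDefectPayoff_proof : Summit.ABC.ABC.Theses.AntisymmetricTwoTorsion.TraceDefectPayoff := by
  unfold Summit.ABC.ABC.Theses.AntisymmetricTwoTorsion.TraceDefectPayoff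
  exact TraceDefectPayoffLine.TraceDefectPayoff_of

end Summit.ABC.ABC.Theorems
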